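import Summits.NavierStokesRegularity.OSWSelfSimilar.SheetNSLineTorusCascadeTail
import HarnessLib

/-!
# Viscous CLM on the torus (`a = 0`, `σ = 2`): the POLE TAIL LEMMA WITH A DEFICIENCY ALLOWANCE — a pole lower bound on finitely
# many modes, some of which may sit BELOW the pole profile by known fractions `ζ_j`, still propagates to ALL higher modes

HONEST FRAMING (cell ns-blowup GROUP B «PROFILE SEARCH», zone Z3, row Z3-U addendum A-F2; human rulings D-0035/D-0074; Z3-TWIN
lineage): **1-D MODEL (viscous Constantin–Lax–Majda equation on `𝕋`); ODE calculus on Fourier-coefficient families, kernel-checked;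
not Euler, not Navier–Stokes; «violates: none — MODEL».**

OBJECT: eng-3's `SheetNSLineTorusCascadeTail` proves: if the modes `j ≤ k₀` of a sine-datum cascade dominate the receding pole
`A j r^j e^{−νjs}` on a window `[α, T]` and `12ν ≤ A(1 − e^{−L})`, then every mode does on `[α + L/(νk₀), T]`, whence blow-up
(`unbounded_of_base`). A certificate feeding it must have EVERY base mode above the pure profile `A j r^j`; in the actual cascade a
few low modes sit slightly below it (at the threshold time mode `3` is `0.47 %` under `12·3·R^{−3}`), which costs the kernel-closed
bound a factor (`19.823` instead of the script-closed `19.7767`, `HOME/profile/z3twin/runs/Z3-cascade-CERT-C_j272195/`). HERE the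
base hypothesis is relaxed to `A j r^j e^{−νjs}(1 − ζ_j) ≤ e_j(s)` with DEFICIENCIES `ζ_j ∈ [0, 1]`, `ζ_j = 0` for `j > k₀`, of total
first moment `Σ_j j ζ_j ≤ Z`; the price is the constant: `12ν ≤ A(1 − e^{−L})(1 − (1 + 12Z)/(k₀+1)²)`.

* `antidiagonal_defect_le` — `Σ_{i+j=k} i j (ζ_i + ζ_j) ≤ 2 k Z`.
* `tail_step_defic` — one mode: if `j < k` dominate `A j r^j e^{−νjs}(1 − ζ_j)` on `[α, T]`, `12Z ≤ k² − 1` and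
  `12νk(k−1) ≤ A(k² − 1 − 12Z)(1 − e^{−ν(k²−k)τ})`, then `A k r^k e^{−νkt} ≤ e_k(t)` on `[α + τ, T]`
  (`½Σ e_ie_j ≥ A² r^k e^{−νks}[(k³ − k)/12 − kZ]`, then eng-3's window argument verbatim).
* `tail_induction_defic`, `unbounded_of_base_defic` — the telescoping induction and the blow-up statement: with `t₁ = α + L/(νk₀) ≤ T`
  and `1 ≤ r e^{−νt₁}`, `k ↦ c_k(t₁)` is unbounded.
READING: this is the kernel half of the Z3-TWIN certificate's upper side (Theorem B of `HOME/profile/z3twin/engine/cascade/README-CERT.md`):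
the script supplies `l_j ≤ e_j` on `J` for `j ≤ 6000` and the deficiencies of the low modes; the theorem supplies the infinite tail.
bears_on: LADDER-NS N5 / zone Z3 (row Z3-U) → N1 linear core. WHAT THIS IS NOT: not NS; no number certified by THIS file; no definitions.
-/

namespace Summit.NavierStokesRegularity.OSWSelfSimilar
namespace SheetNSLineTorusCascade

open Finset Real Set

variable {ν c : ℝ} {e : ℕ → ℝ → ℝ}

/-- **First-moment bound for the deficiency convolution.** If `ζ ≥ 0` and `Σ_{j ≤ k} j ζ_j ≤ Z` then
`Σ_{i+j=k} i j (ζ_i + ζ_j) ≤ 2 k Z` (each `i j ≤ k i` and `i j ≤ k j`). [new here — MODEL] -/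
theorem antidiagonal_defect_le (ζ : ℕ → ℝ) (hζ : ∀ j, 0 ≤ ζ j) {Z : ℝ} (k : ℕ)
    (hZ : ∑ j ∈ range (k + 1), (j : ℝ) * ζ j ≤ Z) :
    ∑ p ∈ antidiagonal k, (p.1 : ℝ) * (p.2 : ℝ) * (ζ p.1 + ζ p.2) ≤ 2 * (k : ℝ) * Z := by
  -- termwise: p1 p2 (ζ p1 + ζ p2) ≤ k (p1 ζ p1) + k (p2 ζ p2)
  have hterm : ∀ p ∈ antidiagonal k,
      (p.1 : ℝ) * (p.2 : ℝ) * (ζ p.1 + ζ p.2) ≤ (k : ℝ) * ((p.1 : ℝ) * ζ p.1) + (k : ℝ) * ((p.2 : ℝ) * ζ p.2) := by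
    intro p hp
    have hsum : p.1 + p.2 = k := mem_antidiagonal.mp hp
    have h1 : (p.1 : ℝ) ≤ k := by exact_mod_cast (by omega : p.1 ≤ k)
    have h2 : (p.2 : ℝ) ≤ k := by exact_mod_cast (by omega : p.2 ≤ k)
    have hp1 : (0 : ℝ) ≤ p.1 := by positivity
    have hp2 : (0 : ℝ) ≤ p.2 := by positivity
    have hz1 := hζ p.1
    have hz2 := hζ p.2
    nlinarith [mul_le_mul_of_nonneg_right h2 (mul_nonneg hp1 hz1), mul_le_mul_of_nonneg_right h1 (mul_nonneg hp2 hz2)]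
  have hfst : ∑ p ∈ antidiagonal k, (p.1 : ℝ) * ζ p.1 = ∑ j ∈ range (k + 1), (j : ℝ) * ζ j := by
    rw [Nat.sum_antidiagonal_eq_sum_range_succ (fun i _ => (i : ℝ) * ζ i) k]
  have hsnd : ∑ p ∈ antidiagonal k, (p.2 : ℝ) * ζ p.2 = ∑ j ∈ range (k + 1), (j : ℝ) * ζ j := by
    rw [← Nat.sum_antidiagonal_swap]
    simp only [Prod.snd_swap]
    rw [Nat.sum_antidiagonal_eq_sum_range_succ (fun i _ => (i : ℝ) * ζ i) k]
  calc ∑ p ∈ antidiagonal k, (p.1 : ℝ) * (p.2 : ℝ) * (ζ p.1 + ζ p.2)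
      ≤ ∑ p ∈ antidiagonal k, ((k : ℝ) * ((p.1 : ℝ) * ζ p.1) + (k : ℝ) * ((p.2 : ℝ) * ζ p.2)) := sum_le_sum hterm
    _ = (k : ℝ) * ∑ p ∈ antidiagonal k, (p.1 : ℝ) * ζ p.1 + (k : ℝ) * ∑ p ∈ antidiagonal k, (p.2 : ℝ) * ζ p.2 := by
      rw [sum_add_distrib, mul_sum, mul_sum]
    _ ≤ (k : ℝ) * Z + (k : ℝ) * Z := by
      rw [hfst, hsnd]
      have hk : (0 : ℝ) ≤ k := by positivity
      have := mul_le_mul_of_nonneg_left hZ hk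
      linarith
    _ = 2 * (k : ℝ) * Z := by ring

/-- **TAIL STEP WITH DEFICIENCIES.** Let `k ≥ 2`, `0 ≤ α`, `0 < τ`, `0 < A`, `0 ≤ r`, deficiencies `0 ≤ ζ_j ≤ 1` with
`Σ_{j ≤ k} j ζ_j ≤ Z`, `12 Z ≤ k² − 1`, and suppose `12νk(k−1) ≤ A(k² − 1 − 12Z)(1 − e^{−ν(k²−k)τ})`. If every mode `j < k` satisfies
`A j r^j e^{−νjs}(1 − ζ_j) ≤ e_j(s)` for `s ∈ [α, T]`, then `A k r^k e^{−νkt} ≤ e_k(t)` for `t ∈ [α + τ, T]`. [new here — MODEL] -/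
theorem tail_step_defic (he : IsSineCascade ν c e) (hν : 0 < ν) (hc : 0 ≤ c) {A r α T τ Z : ℝ} (hA : 0 < A) (hr : 0 ≤ r)
    (hα : 0 ≤ α) (hτ : 0 < τ) {k : ℕ} (hk : 2 ≤ k) (ζ : ℕ → ℝ) (hζ0 : ∀ j, 0 ≤ ζ j) (hζ1 : ∀ j, ζ j ≤ 1)
    (hZ : ∑ j ∈ range (k + 1), (j : ℝ) * ζ j ≤ Z) (hZk : 12 * Z ≤ (k : ℝ) ^ 2 - 1)
    (hcond : 12 * ν * (k : ℝ) * ((k : ℝ) - 1)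
      ≤ A * ((k : ℝ) ^ 2 - 1 - 12 * Z) * (1 - exp (-(ν * ((k : ℝ) ^ 2 - k) * τ))))
    (hyp : ∀ j, j < k → ∀ s ∈ Icc α T, A * (j : ℝ) * r ^ j * exp (-(ν * (j : ℝ) * s)) * (1 - ζ j) ≤ e j s) :
    ∀ t ∈ Icc (α + τ) T, A * (k : ℝ) * r ^ k * exp (-(ν * (k : ℝ) * t)) ≤ e k t := by
  intro t ht
  have hk1 : (1 : ℝ) < k := by exact_mod_cast hk
  have hkk : 0 < (k : ℝ) ^ 2 - k := by nlinarith
  have hkm1 : 0 < (k : ℝ) - 1 := by linarith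
  have hαt : α < t := by linarith [ht.1]
  have htT : t ≤ T := ht.2
  have hZ0 : 0 ≤ Z := le_trans (sum_nonneg fun j _ => mul_nonneg (by positivity) (hζ0 j)) hZ
  -- B := A² r^k (k² − 1 − 12Z) / (12 ν (k − 1)) ≥ 0
  set B : ℝ := A ^ 2 * r ^ k * ((k : ℝ) ^ 2 - 1 - 12 * Z) / (12 * ν * ((k : ℝ) - 1)) with hB
  have hB0 : 0 ≤ B := by
    rw [hB]
    apply div_nonneg
    · have : 0 ≤ (k : ℝ) ^ 2 - 1 - 12 * Z := by linarith
      positivity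
    · positivity
  set G : ℝ → ℝ := fun s => B * exp (ν * ((k : ℝ) ^ 2 - k) * s) with hG
  have hG' : ∀ s, HasDerivAt G (B * (exp (ν * ((k : ℝ) ^ 2 - k) * s) * (ν * ((k : ℝ) ^ 2 - k)))) s := by
    intro s
    have := ((hasDerivAt_id s).const_mul (ν * ((k : ℝ) ^ 2 - k))).exp.const_mul B
    simpa using this
  -- the deficient convolution lower bound: Σ e_i e_j ≥ A² r^k e^{−νks} ((k³−k)/6 − 2kZ)
  have hconv : ∀ s, α < s → s ≤ T →
      A ^ 2 * r ^ k * exp (-(ν * (k : ℝ) * s)) * (((k : ℝ) ^ 3 - k) / 6 - 2 * (k : ℝ) * Z)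
        ≤ ∑ p ∈ antidiagonal k, e p.1 s * e p.2 s := by
    intro s hs hsT
    -- termwise: m_i m_j (1 − ζ_i − ζ_j) ≤ (m_i(1−ζ_i)) (m_j(1−ζ_j)) ≤ e_i e_j
    have hterm : ∀ p ∈ antidiagonal k,
        (A * (p.1 : ℝ) * r ^ p.1 * exp (-(ν * (p.1 : ℝ) * s))) * (A * (p.2 : ℝ) * r ^ p.2 * exp (-(ν * (p.2 : ℝ) * s)))
            * (1 - ζ p.1 - ζ p.2)
          ≤ e p.1 s * e p.2 s := by
      intro p hp
      have hsum : p.1 + p.2 = k := mem_antidiagonal.mp hp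
      set m1 : ℝ := A * (p.1 : ℝ) * r ^ p.1 * exp (-(ν * (p.1 : ℝ) * s)) with hm1
      set m2 : ℝ := A * (p.2 : ℝ) * r ^ p.2 * exp (-(ν * (p.2 : ℝ) * s)) with hm2
      have hm10 : 0 ≤ m1 := by positivity
      have hm20 : 0 ≤ m2 := by positivity
      have hz1 := hζ0 p.1; have hz2 := hζ0 p.2; have hz1' := hζ1 p.1; have hz2' := hζ1 p.2
      -- (1 − ζ1 − ζ2) ≤ (1 − ζ1)(1 − ζ2)
      have hdef : m1 * m2 * (1 - ζ p.1 - ζ p.2) ≤ (m1 * (1 - ζ p.1)) * (m2 * (1 - ζ p.2)) := by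
        have : 0 ≤ m1 * m2 * (ζ p.1 * ζ p.2) := by positivity
        nlinarith
      refine le_trans hdef ?_
      rcases Nat.eq_zero_or_pos p.1 with h1 | h1
      · have : m1 = 0 := by rw [hm1, h1]; simp
        rw [this, h1, he.zero]; simp
      rcases Nat.eq_zero_or_pos p.2 with h2 | h2
      · have : m2 = 0 := by rw [hm2, h2]; simp
        rw [this, h2, he.zero]; simp
      have ha := hyp p.1 (by omega) s ⟨hs.le, hsT⟩
      have hb := hyp p.2 (by omega) s ⟨hs.le, hsT⟩
      have ha0 : 0 ≤ m1 * (1 - ζ p.1) := mul_nonneg hm10 (by linarith)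
      exact mul_le_mul ha hb (mul_nonneg hm20 (by linarith)) (le_trans ha0 ha)
    -- sum the termwise bound and identify the left side
    have hsumid : ∑ p ∈ antidiagonal k,
        (A * (p.1 : ℝ) * r ^ p.1 * exp (-(ν * (p.1 : ℝ) * s))) * (A * (p.2 : ℝ) * r ^ p.2 * exp (-(ν * (p.2 : ℝ) * s)))
            * (1 - ζ p.1 - ζ p.2)
        = A ^ 2 / 6 * ((k : ℝ) ^ 3 - k) * r ^ k * exp (-(ν * (k : ℝ) * s))
          - A ^ 2 * r ^ k * exp (-(ν * (k : ℝ) * s)) * ∑ p ∈ antidiagonal k, (p.1 : ℝ) * (p.2 : ℝ) * (ζ p.1 + ζ p.2) := by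
      rw [← generalPole_conv ν A r k s, mul_sum, ← sum_sub_distrib]
      refine sum_congr rfl fun p hp => ?_
      have hsum : p.1 + p.2 = k := mem_antidiagonal.mp hp
      have hrr : r ^ p.1 * r ^ p.2 = r ^ k := by rw [← pow_add, hsum]
      have hee : exp (-(ν * (p.1 : ℝ) * s)) * exp (-(ν * (p.2 : ℝ) * s)) = exp (-(ν * (k : ℝ) * s)) := by
        rw [← exp_add]; congr 1
        have : ((k : ℕ) : ℝ) = (p.1 : ℝ) + (p.2 : ℝ) := by rw [← hsum]; push_cast; ring
        rw [this]; ring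
      have hprod : (A * (p.1 : ℝ) * r ^ p.1 * exp (-(ν * (p.1 : ℝ) * s))) * (A * (p.2 : ℝ) * r ^ p.2 * exp (-(ν * (p.2 : ℝ) * s)))
          = A ^ 2 * r ^ k * exp (-(ν * (k : ℝ) * s)) * ((p.1 : ℝ) * (p.2 : ℝ)) := by
        calc (A * (p.1 : ℝ) * r ^ p.1 * exp (-(ν * (p.1 : ℝ) * s))) * (A * (p.2 : ℝ) * r ^ p.2 * exp (-(ν * (p.2 : ℝ) * s)))
            = A ^ 2 * (r ^ p.1 * r ^ p.2) * (exp (-(ν * (p.1 : ℝ) * s)) * exp (-(ν * (p.2 : ℝ) * s)))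
                * ((p.1 : ℝ) * (p.2 : ℝ)) := by ring
          _ = A ^ 2 * r ^ k * exp (-(ν * (k : ℝ) * s)) * ((p.1 : ℝ) * (p.2 : ℝ)) := by rw [hrr, hee]
      rw [hprod]; ring
    have hdefect := antidiagonal_defect_le ζ hζ0 k hZ
    have hpos : 0 ≤ A ^ 2 * r ^ k * exp (-(ν * (k : ℝ) * s)) := by positivity
    calc A ^ 2 * r ^ k * exp (-(ν * (k : ℝ) * s)) * (((k : ℝ) ^ 3 - k) / 6 - 2 * (k : ℝ) * Z)
        = A ^ 2 / 6 * ((k : ℝ) ^ 3 - k) * r ^ k * exp (-(ν * (k : ℝ) * s))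
            - A ^ 2 * r ^ k * exp (-(ν * (k : ℝ) * s)) * (2 * (k : ℝ) * Z) := by ring
      _ ≤ A ^ 2 / 6 * ((k : ℝ) ^ 3 - k) * r ^ k * exp (-(ν * (k : ℝ) * s))
            - A ^ 2 * r ^ k * exp (-(ν * (k : ℝ) * s)) * ∑ p ∈ antidiagonal k, (p.1 : ℝ) * (p.2 : ℝ) * (ζ p.1 + ζ p.2) := by
          linarith [mul_le_mul_of_nonneg_left hdefect hpos]
      _ = ∑ p ∈ antidiagonal k,
            (A * (p.1 : ℝ) * r ^ p.1 * exp (-(ν * (p.1 : ℝ) * s))) * (A * (p.2 : ℝ) * r ^ p.2 * exp (-(ν * (p.2 : ℝ) * s)))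
              * (1 - ζ p.1 - ζ p.2) := hsumid.symm
      _ ≤ ∑ p ∈ antidiagonal k, e p.1 s * e p.2 s := sum_le_sum hterm
  -- G′(s) = e^{νk²s} · ½ · A² r^k e^{−νks} ((k³−k)/6 − 2kZ)
  have hGconv : ∀ s, B * (exp (ν * ((k : ℝ) ^ 2 - k) * s) * (ν * ((k : ℝ) ^ 2 - k)))
      = exp (ν * (k : ℝ) ^ 2 * s) * ((1 / 2) * (A ^ 2 * r ^ k * exp (-(ν * (k : ℝ) * s))
          * (((k : ℝ) ^ 3 - k) / 6 - 2 * (k : ℝ) * Z))) := by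
    intro s
    have hsplit : exp (ν * ((k : ℝ) ^ 2 - k) * s) = exp (ν * (k : ℝ) ^ 2 * s) * exp (-(ν * (k : ℝ) * s)) := by
      rw [← exp_add]; congr 1; ring
    rw [hsplit, hB]
    have hν0 : ν ≠ 0 := hν.ne'
    have hk0 : (k : ℝ) - 1 ≠ 0 := hkm1.ne'
    field_simp
    ring
  -- φ = D − G non-decreasing on [α, T]
  set D : ℝ → ℝ := fun s => exp (ν * (k : ℝ) ^ 2 * s) * e k s with hD
  have hφmono : MonotoneOn (fun s => D s - G s) (Icc α T) := by
    refine monotoneOn_of_hasDerivWithinAt_nonneg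
      (f' := fun s => exp (ν * (k : ℝ) ^ 2 * s) * ((1 / 2) * ∑ p ∈ antidiagonal k, e p.1 s * e p.2 s)
        - B * (exp (ν * ((k : ℝ) ^ 2 - k) * s) * (ν * ((k : ℝ) ^ 2 - k))))
      (convex_Icc α T) ?_ (fun s hs => ?_) (fun s hs => ?_)
    · exact ((continuousOn_weighted he k).mono (fun s hs => le_trans hα hs.1)).sub
        ((continuous_const.mul (continuous_exp.comp (continuous_const.mul continuous_id))).continuousOn)
    · rw [interior_Icc] at hs ⊢
      exact ((hasDerivAt_weighted he k (lt_of_le_of_lt hα hs.1)).sub (hG' s)).hasDerivWithinAt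
    · rw [interior_Icc] at hs
      rw [hGconv s, ← mul_sub, ← mul_sub]
      refine mul_nonneg (exp_pos _).le (mul_nonneg (by norm_num) ?_)
      rw [sub_nonneg]
      exact hconv s hs.1 hs.2.le
  have hαT : α ≤ T := le_trans hαt.le htT
  have hDα : 0 ≤ D α := mul_nonneg (exp_pos _).le (nonneg he hc k α hα)
  have hmain : G t - G α ≤ D t := by
    have := hφmono ⟨le_rfl, hαT⟩ ⟨hαt.le, htT⟩ hαt.le
    simp only at this
    linarith
  -- the window: G α ≤ e^{−x} G t with x = ν(k²−k)τ
  set x : ℝ := ν * ((k : ℝ) ^ 2 - k) * τ with hx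
  have hwin : G α ≤ exp (-x) * G t := by
    show B * exp (ν * ((k : ℝ) ^ 2 - k) * α) ≤ exp (-x) * (B * exp (ν * ((k : ℝ) ^ 2 - k) * t))
    have h1 : exp (ν * ((k : ℝ) ^ 2 - k) * α) ≤ exp (-x) * exp (ν * ((k : ℝ) ^ 2 - k) * t) := by
      rw [← exp_add]
      apply exp_le_exp.mpr
      have : ν * ((k : ℝ) ^ 2 - k) * (t - α) ≥ x := by
        rw [hx]; exact mul_le_mul_of_nonneg_left (by linarith [ht.1]) (by positivity)
      linarith
    nlinarith [hB0, mul_le_mul_of_nonneg_left h1 hB0]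
  have hDlow : (1 - exp (-x)) * G t ≤ D t := by nlinarith
  -- conclude
  have hGt : G t = B * exp (ν * ((k : ℝ) ^ 2 - k) * t) := rfl
  have hek : e k t = exp (-(ν * (k : ℝ) ^ 2 * t)) * D t := by
    show e k t = exp (-(ν * (k : ℝ) ^ 2 * t)) * (exp (ν * (k : ℝ) ^ 2 * t) * e k t)
    rw [← mul_assoc, ← exp_add]; simp
  rw [hek]
  have hE : 0 < exp (-(ν * (k : ℝ) ^ 2 * t)) := exp_pos _
  have hstep2 : exp (-(ν * (k : ℝ) ^ 2 * t)) * ((1 - exp (-x)) * G t)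
      ≤ exp (-(ν * (k : ℝ) ^ 2 * t)) * D t := mul_le_mul_of_nonneg_left hDlow hE.le
  refine le_trans ?_ hstep2
  rw [hGt, hB]
  have hsplit : exp (-(ν * (k : ℝ) * t)) = exp (-(ν * (k : ℝ) ^ 2 * t)) * exp (ν * ((k : ℝ) ^ 2 - k) * t) := by
    rw [← exp_add]; congr 1; ring
  rw [hsplit]
  have hrk : 0 ≤ r ^ k := pow_nonneg hr k
  have hν0 : ν ≠ 0 := hν.ne'
  -- A k r^k ≤ (1 − e^{−x}) B   ⇔   12νk(k−1)·(A r^k) ≤ (1 − e^{−x}) A² r^k (k² − 1 − 12Z)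
  have key : A * (k : ℝ) * r ^ k ≤ (1 - exp (-x)) * (A ^ 2 * r ^ k * ((k : ℝ) ^ 2 - 1 - 12 * Z) / (12 * ν * ((k : ℝ) - 1))) := by
    rw [hx]
    have h1 : A * (k : ℝ) * r ^ k * (12 * ν * ((k : ℝ) - 1))
        ≤ (1 - exp (-(ν * ((k : ℝ) ^ 2 - k) * τ))) * (A ^ 2 * r ^ k * ((k : ℝ) ^ 2 - 1 - 12 * Z)) := by
      have := mul_le_mul_of_nonneg_left hcond (mul_nonneg hA.le hrk)
      nlinarith
    rw [← mul_div_assoc, le_div_iff₀ (by positivity)]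
    linarith
  calc A * (k : ℝ) * r ^ k * (exp (-(ν * (k : ℝ) ^ 2 * t)) * exp (ν * ((k : ℝ) ^ 2 - k) * t))
      = (exp (-(ν * (k : ℝ) ^ 2 * t)) * exp (ν * ((k : ℝ) ^ 2 - k) * t)) * (A * (k : ℝ) * r ^ k) := by ring
    _ ≤ (exp (-(ν * (k : ℝ) ^ 2 * t)) * exp (ν * ((k : ℝ) ^ 2 - k) * t))
          * ((1 - exp (-x)) * (A ^ 2 * r ^ k * ((k : ℝ) ^ 2 - 1 - 12 * Z) / (12 * ν * ((k : ℝ) - 1)))) :=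
        mul_le_mul_of_nonneg_left key (by positivity)
    _ = exp (-(ν * (k : ℝ) ^ 2 * t)) * ((1 - exp (-x)) * (A ^ 2 * r ^ k * ((k : ℝ) ^ 2 - 1 - 12 * Z)
          / (12 * ν * ((k : ℝ) - 1)) * exp (ν * ((k : ℝ) ^ 2 - k) * t))) := by ring

/-- **TAIL INDUCTION WITH DEFICIENCIES.** Let `0 < L`, `0 < A`, `0 ≤ r`, `0 ≤ α`, `1 ≤ k₀`, deficiencies `0 ≤ ζ_j ≤ 1` with
`ζ_j = 0` for `j > k₀` and `Σ_{j ≤ n} j ζ_j ≤ Z` for every `n`, `1 + 12Z ≤ (k₀+1)²`, and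
`12ν ≤ A(1 − e^{−L})(1 − (1 + 12Z)/(k₀+1)²)`. If the modes `j ≤ k₀` satisfy `A j r^j e^{−νjs}(1 − ζ_j) ≤ e_j(s)` on `[α, T]`, then every
mode `k > k₀` satisfies `A k r^k e^{−νkt} ≤ e_k(t)` on `[α + L/(νk₀), T]`. [new here — MODEL] -/
theorem tail_induction_defic (he : IsSineCascade ν c e) (hν : 0 < ν) (hc : 0 ≤ c) {A r α T L Z : ℝ} (hA : 0 < A) (hr : 0 ≤ r)
    (hα : 0 ≤ α) (hL : 0 < L) {k₀ : ℕ} (hk₀ : 1 ≤ k₀) (ζ : ℕ → ℝ) (hζ0 : ∀ j, 0 ≤ ζ j) (hζ1 : ∀ j, ζ j ≤ 1)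
    (hζsupp : ∀ j, k₀ < j → ζ j = 0) (hZ : ∀ n, ∑ j ∈ range (n + 1), (j : ℝ) * ζ j ≤ Z)
    (hZk : 1 + 12 * Z ≤ ((k₀ : ℝ) + 1) ^ 2)
    (hAL : 12 * ν ≤ A * (1 - exp (-L)) * (1 - (1 + 12 * Z) / ((k₀ : ℝ) + 1) ^ 2))
    (base : ∀ j, j ≤ k₀ → ∀ s ∈ Icc α T, A * (j : ℝ) * r ^ j * exp (-(ν * (j : ℝ) * s)) * (1 - ζ j) ≤ e j s) :
    ∀ k : ℕ, k₀ < k → ∀ t ∈ Icc (α + L / (ν * (k₀ : ℝ))) T, A * (k : ℝ) * r ^ k * exp (-(ν * (k : ℝ) * t)) ≤ e k t := by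
  have hk₀pos : (0 : ℝ) < k₀ := by exact_mod_cast hk₀
  have hZ0 : 0 ≤ Z := le_trans (by simp) (hZ 0)
  have h1eL : 0 ≤ 1 - exp (-L) := by
    have : exp (-L) ≤ 1 := exp_le_one_iff.mpr (by linarith)
    linarith
  -- P(k): all modes j ≤ k dominate the deficient profile on [α_k, T], α_k = α + (L/ν)(1/k₀ − 1/k), for k ≥ k₀
  have P : ∀ k : ℕ, k₀ ≤ k → ∀ j, j ≤ k → ∀ s ∈ Icc (α + L / ν * (1 / (k₀ : ℝ) - 1 / (k : ℝ))) T,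
      A * (j : ℝ) * r ^ j * exp (-(ν * (j : ℝ) * s)) * (1 - ζ j) ≤ e j s := by
    intro k hk
    induction k, hk using Nat.le_induction with
    | base =>
      intro j hj s hs
      refine base j hj s ⟨?_, hs.2⟩
      have : α + L / ν * (1 / (k₀ : ℝ) - 1 / (k₀ : ℝ)) = α := by ring
      linarith [hs.1]
    | succ n hn ih =>
      intro j hj s hs
      have hnpos : (0 : ℝ) < n := by exact_mod_cast (lt_of_lt_of_le (by omega : 0 < k₀) hn)
      have hτ : 0 < L / (ν * ((n : ℝ) + 1) * (n : ℝ)) := by positivity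
      have hstep : α + L / ν * (1 / (k₀ : ℝ) - 1 / ((n + 1 : ℕ) : ℝ))
          = (α + L / ν * (1 / (k₀ : ℝ) - 1 / (n : ℝ))) + L / (ν * ((n : ℝ) + 1) * (n : ℝ)) := by
        have hν0 : ν ≠ 0 := hν.ne'
        have hn0 : (n : ℝ) ≠ 0 := hnpos.ne'
        push_cast
        field_simp
        ring
      rcases Nat.lt_or_ge j (n + 1) with hlt | hge
      · refine ih j (by omega) s ⟨?_, hs.2⟩
        rw [hstep] at hs
        linarith [hs.1, hτ.le]
      · have hjn : j = n + 1 := le_antisymm hj hge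
        subst hjn
        have hαn : 0 ≤ α + L / ν * (1 / (k₀ : ℝ) - 1 / (n : ℝ)) := by
          have h1 : 1 / (n : ℝ) ≤ 1 / (k₀ : ℝ) := one_div_le_one_div_of_le hk₀pos (by exact_mod_cast hn)
          have h2 : 0 ≤ L / ν := div_nonneg hL.le hν.le
          nlinarith
        -- the deficient step at k = n + 1 ≥ k₀ + 1 ≥ 2
        have hk2 : 2 ≤ n + 1 := by omega
        set kk : ℝ := ((n + 1 : ℕ) : ℝ) with hkk_def
        have hkk1 : ((k₀ : ℝ) + 1) ≤ kk := by rw [hkk_def]; push_cast; exact_mod_cast Nat.succ_le_succ hn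
        have hkk0 : 0 < kk := by linarith
        -- 12Z ≤ kk² − 1 and the step condition with x = L
        have hZk' : 12 * Z ≤ kk ^ 2 - 1 := by nlinarith
        have hx : ν * (kk ^ 2 - kk) * (L / (ν * ((n : ℝ) + 1) * (n : ℝ))) = L := by
          have hν0 : ν ≠ 0 := hν.ne'
          have hn0 : (n : ℝ) ≠ 0 := hnpos.ne'
          rw [hkk_def]; push_cast
          field_simp
          ring
        have hcond : 12 * ν * kk * (kk - 1) ≤ A * (kk ^ 2 - 1 - 12 * Z) * (1 - exp (-(ν * (kk ^ 2 - kk)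
            * (L / (ν * ((n : ℝ) + 1) * (n : ℝ)))))) := by
          rw [hx]
          -- 12ν kk(kk−1) ≤ 12ν kk² ≤ A(1−e^{−L}) c₀ kk² ≤ A(1−e^{−L})(kk² − 1 − 12Z),  c₀ = 1 − (1+12Z)/(k₀+1)²
          have hc0 : (1 - (1 + 12 * Z) / ((k₀ : ℝ) + 1) ^ 2) * kk ^ 2 ≤ kk ^ 2 - 1 - 12 * Z := by
            have hpos : (0 : ℝ) < ((k₀ : ℝ) + 1) ^ 2 := by positivity
            have hsq : ((k₀ : ℝ) + 1) ^ 2 ≤ kk ^ 2 := pow_le_pow_left₀ (by positivity) hkk1 2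
            have hge1 : 1 ≤ kk ^ 2 / ((k₀ : ℝ) + 1) ^ 2 := by rw [le_div_iff₀ hpos]; linarith
            have hfrac : 1 + 12 * Z ≤ (1 + 12 * Z) / ((k₀ : ℝ) + 1) ^ 2 * kk ^ 2 := by
              have hre : (1 + 12 * Z) / ((k₀ : ℝ) + 1) ^ 2 * kk ^ 2 = (1 + 12 * Z) * (kk ^ 2 / ((k₀ : ℝ) + 1) ^ 2) := by
                ring
              rw [hre]
              have h12Z : 0 ≤ 1 + 12 * Z := by linarith
              nlinarith
            nlinarith
          have h12 : 12 * ν * kk * (kk - 1) ≤ 12 * ν * kk ^ 2 := by nlinarith [hν.le]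
          have h3 : 12 * ν * kk ^ 2 ≤ A * (1 - exp (-L)) * (1 - (1 + 12 * Z) / ((k₀ : ℝ) + 1) ^ 2) * kk ^ 2 :=
            mul_le_mul_of_nonneg_right hAL (by positivity)
          have h4 : A * (1 - exp (-L)) * (1 - (1 + 12 * Z) / ((k₀ : ℝ) + 1) ^ 2) * kk ^ 2
              ≤ A * (1 - exp (-L)) * (kk ^ 2 - 1 - 12 * Z) := by
            have := mul_le_mul_of_nonneg_left hc0 (mul_nonneg hA.le h1eL)
            linarith
          calc 12 * ν * kk * (kk - 1) ≤ 12 * ν * kk ^ 2 := h12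
            _ ≤ A * (1 - exp (-L)) * (1 - (1 + 12 * Z) / ((k₀ : ℝ) + 1) ^ 2) * kk ^ 2 := h3
            _ ≤ A * (1 - exp (-L)) * (kk ^ 2 - 1 - 12 * Z) := h4
            _ = A * (kk ^ 2 - 1 - 12 * Z) * (1 - exp (-L)) := by ring
        have hres := tail_step_defic he hν hc hA hr hαn hτ hk2 ζ hζ0 hζ1 (hZ (n + 1)) hZk' hcond
          (fun i hi s' hs' => ih i (by omega) s' hs') s (by rw [hstep] at hs; exact hs)
        -- mode n+1 > k₀ has no deficiency
        rw [hζsupp (n + 1) (by omega), sub_zero, mul_one]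
        exact hres
  intro k hk t ht
  have hres := P k hk.le k le_rfl t ⟨?_, ht.2⟩
  · rw [hζsupp k hk, sub_zero, mul_one] at hres
    exact hres
  · have hkpos : (0 : ℝ) < k := by exact_mod_cast (lt_of_lt_of_le (by omega : 0 < k₀) hk.le)
    have h1 : L / ν * (1 / (k₀ : ℝ) - 1 / (k : ℝ)) ≤ L / (ν * (k₀ : ℝ)) := by
      have hν0 : ν ≠ 0 := hν.ne'
      have hk0' : (k₀ : ℝ) ≠ 0 := hk₀pos.ne'
      have hk' : (k : ℝ) ≠ 0 := hkpos.ne'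
      have e1 : L / ν * (1 / (k₀ : ℝ) - 1 / (k : ℝ)) = L / (ν * (k₀ : ℝ)) - L / (ν * (k : ℝ)) := by
        field_simp
      have e2 : 0 ≤ L / (ν * (k : ℝ)) := by positivity
      linarith
    linarith [ht.1]

/-- **BLOW-UP FROM A CERTIFIED BASE WITH DEFICIENCIES.** Under the hypotheses of `tail_induction_defic`, if
`t₁ := α + L/(νk₀) ≤ T` and `1 ≤ r e^{−νt₁}`, then `k ↦ c_k(t₁)` is unbounded (`c_k(t₁) ≥ A k` for `k > k₀`): no solution with
bounded Fourier coefficients survives to `t₁`. [new here — MODEL] -/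
theorem unbounded_of_base_defic (he : IsSineCascade ν c e) (hν : 0 < ν) (hc : 0 ≤ c) {A r α T L Z : ℝ} (hA : 0 < A)
    (hr : 0 ≤ r) (hα : 0 ≤ α) (hL : 0 < L) {k₀ : ℕ} (hk₀ : 1 ≤ k₀) (ζ : ℕ → ℝ) (hζ0 : ∀ j, 0 ≤ ζ j) (hζ1 : ∀ j, ζ j ≤ 1)
    (hζsupp : ∀ j, k₀ < j → ζ j = 0) (hZ : ∀ n, ∑ j ∈ range (n + 1), (j : ℝ) * ζ j ≤ Z)
    (hZk : 1 + 12 * Z ≤ ((k₀ : ℝ) + 1) ^ 2)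
    (hAL : 12 * ν ≤ A * (1 - exp (-L)) * (1 - (1 + 12 * Z) / ((k₀ : ℝ) + 1) ^ 2))
    (base : ∀ j, j ≤ k₀ → ∀ s ∈ Icc α T, A * (j : ℝ) * r ^ j * exp (-(ν * (j : ℝ) * s)) * (1 - ζ j) ≤ e j s)
    (hT : α + L / (ν * (k₀ : ℝ)) ≤ T) (hrt : 1 ≤ r * exp (-(ν * (α + L / (ν * (k₀ : ℝ)))))) :
    ∀ M : ℝ, ∃ k : ℕ, M < e k (α + L / (ν * (k₀ : ℝ))) := by
  intro M
  set t₁ := α + L / (ν * (k₀ : ℝ)) with ht₁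
  obtain ⟨k, hk⟩ := exists_nat_gt (max (M / A) (k₀ : ℝ))
  have hkM : M / A < k := lt_of_le_of_lt (le_max_left _ _) hk
  have hkk₀ : k₀ < k := by
    have : (k₀ : ℝ) < k := lt_of_le_of_lt (le_max_right _ _) hk
    exact_mod_cast this
  refine ⟨k, lt_of_lt_of_le ?_
    (tail_induction_defic he hν hc hA hr hα hL hk₀ ζ hζ0 hζ1 hζsupp hZ hZk hAL base k hkk₀ t₁ ⟨le_rfl, hT⟩)⟩
  have hq : (1 : ℝ) ≤ (r * exp (-(ν * t₁))) ^ k := one_le_pow₀ hrt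
  have hid : A * (k : ℝ) * r ^ k * exp (-(ν * (k : ℝ) * t₁)) = A * (k : ℝ) * (r * exp (-(ν * t₁))) ^ k := by
    have hx : exp (-(ν * (k : ℝ) * t₁)) = exp (-(ν * t₁)) ^ k := by
      rw [← exp_nat_mul]; congr 1; ring
    rw [hx, mul_pow]; ring
  rw [hid]
  have hM : M < A * (k : ℝ) := by rw [div_lt_iff₀ hA] at hkM; linarith
  nlinarith [mul_le_mul_of_nonneg_left hq (by positivity : (0:ℝ) ≤ A * (k : ℝ))]

end SheetNSLineTorusCascade
end Summit.NavierStokesRegularity.OSWSelfSimilar
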